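import Summits.AtomisticToContinuum.BoseEinsteinCondensation.Theses.BECHeatBathGap
import Literature.Analysis.FunctionSpaces.NuclearSpace

/-!
# Crux `ParticleTensorisation` (stmt-AtomisticToContinuum-14367), line `registered` — lead's checked remarks

Companion to `Lines/registered.dead.md` (lead prover, 2026-08-17). Two kernel-checked facts used in the
dead-line report:

* `undressedWitness_of_particleTensorisation` — the verification stub `stub_undressedWitness` of the line is
  IMPLIED by the crux (take `U = 0`, which is continuous, even, Bochner-positive-definite and bounded by any
  `u₀ > 0`; the undressing factor is then `exp 0 = 1`). Hence, granted the criterion stub, the verification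
  stub is EQUIVALENT to the crux: the line relocates the crux, it does not cut it, unless a NONZERO admissible
  `U` makes the undressed law tractable — and the clause `∀ δ > 0` (absolute slack) excludes every explicit
  trial state as the witness `Θ`.
* `isPositiveDefinite_zero'` — the zero kernel is admissible (typing check of the corner `U = 0`).

No `sorry`; nothing here is proposed to `Theorems/` (these are remarks about the LINE, not results toward the
crux).
-/

noncomputable section

open MeasureTheory Filter
open scoped ENNReal NNReal ComplexConjugate

namespace Summit.AtomisticToContinuum.BoseEinsteinCondensation.Cruxes.ParticleTensorisation.RegisteredDead

open Literature.MathematicalPhysics.QuantumManyBody.BoseGas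

/-- The zero kernel `ℝ³ → ℂ` is positive definite in the tree's (Bochner) sense: every Hermitian form it
defines is identically `0`. [folklore] -/
theorem isPositiveDefinite_zero' :
    Literature.Analysis.FunctionSpaces.IsPositiveDefinite
      (fun x : EuclideanSpace ℝ (Fin 3) => (((fun _ => (0 : ℝ)) x : ℝ) : ℂ)) := by
  intro n x c
  simp

/-- **The crux implies the line's verification stub** (`stub_undressedWitness`, verbatim signature as the
conclusion): given `ParticleTensorisation`, for every `v` and every threshold `u₀ > 0` take the crux's
`ρ₀, C` and witnesses `Θ`, and the kernel `U = 0`; the undressing factor `exp ((Σ_{k<l} 0)/2) = 1`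
disappears. So `stub_undressedWitness` is a CONSEQUENCE of the crux, and together with the criterion stub it
is equivalent to it. [folklore] -/
theorem undressedWitness_of_particleTensorisation
    (h : Theses.BECHeatBathGap.ParticleTensorisation) :
    ∀ v : ℝ → ℝ≥0∞, IsRepulsiveFiniteRange v → ∀ u₀ : ℝ, 0 < u₀ → ∃ ρ₀ : ℝ, 0 < ρ₀ ∧ ∃ C₁ : ℝ, 0 <
      C₁ ∧ ∀ ρ : ℝ, 0 < ρ → ρ < ρ₀ → ∀ᶠ N : ℕ in atTop, ∀ δ : ℝ≥0∞, 0 < δ → ∃ Θ : TrialState N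
      (sideLength ρ (N + 1)), energy v Θ ≤ groundStateEnergy v N (sideLength ρ (N + 1)) + δ ∧ ∃ U :
      EuclideanSpace ℝ (Fin 3) → ℝ, Continuous U ∧ (∀ x, U (-x) = U x) ∧
      Literature.Analysis.FunctionSpaces.IsPositiveDefinite (fun x => (U x : ℂ)) ∧ (∀ x, |U x| ≤ u₀)
      ∧ (∀ (F : (Fin N → EuclideanSpace ℝ (Fin 3)) → ℂ) (g : Fin N → (Fin N → EuclideanSpace ℝ (Fin
      3)) → ℂ), Measurable F → (∀ i, Measurable (g i)) → (∃ M : ℝ, ∀ X, ‖F X‖ ≤ M ∧ ∀ i, ‖g i X‖ ≤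
      M) → (∀ i X x, g i (Function.update X i x) = g i X) → ∃ c : ℂ, (∫⁻ X in boxN N (sideLength ρ
      (N + 1)), (‖F X - c * (Θ.ψ X * (Real.exp ((∑ k : Fin N, ∑ l : Fin N with k < l, U (X k - X l))
      / 2) : ℂ))‖₊ : ℝ≥0∞) ^ 2) ≤ ENNReal.ofReal C₁ * ∑ i : Fin N, ∫⁻ X in boxN N (sideLength ρ (N +
      1)), (‖F X - g i X * (Θ.ψ X * (Real.exp ((∑ k : Fin N, ∑ l : Fin N with k < l, U (X k - X l))
      / 2) : ℂ))‖₊ : ℝ≥0∞) ^ 2) := by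
  intro v hv u₀ hu₀
  obtain ⟨ρ₀, hρ₀, C, hC, hcrux⟩ := h v hv
  refine ⟨ρ₀, hρ₀, C, hC, fun ρ hρ hρlt => ?_⟩
  filter_upwards [hcrux ρ hρ hρlt] with N hN
  intro δ hδ
  obtain ⟨Θ, hE, hAT⟩ := hN δ hδ
  refine ⟨Θ, hE, fun _ => 0, continuous_const, fun _ => rfl, isPositiveDefinite_zero', fun _ => by
    simpa using hu₀.le, ?_⟩
  intro F g hF hg hM hupd
  simpa using hAT F g hF hg hM hupd

end Summit.AtomisticToContinuum.BoseEinsteinCondensation.Cruxes.ParticleTensorisation.RegisteredDead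

end
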